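import Literature.MathematicalPhysics.QuantumFieldTheory.Balaban1983to89.B7Prop1Explicit
import Literature.MathematicalPhysics.QuantumFieldTheory.Balaban1983to89.T4TermwiseQuartic

/-!
# T⁴ continuum, node U5 (NE7), TERM-WISE member — the BCH binder (bch) and the transport binder (tr) of generation 10
# PRODUCED for Bałaban's concrete one-step average (42): the coarse Lie-algebra variable `log V̄(∂p′)` IS the
# `L^{−d}`-weighted window sum of the PARALLEL-TRANSPORTED fine variables `T log V(∂p) T⁻¹` up to `280·θ²`,
# `θ = 8(d+1)(d+4)L²α₀` — B7 (45), (47)–(50) with the first-order term KEPT, then (26)–(27)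

Lineage t4-ne7-p1 (term-wise matching modulo constants), generation 11; v1.1 = generation 12's DOCFIX (docstrings only,
every declaration byte-identical; XREAD C-ref6-161 D1: the `L^{−d}` weights of the window average are display (42) p. 23 —
the citation «(35) p. 23» of v1, which is the even-part identity for `g⁻¹`, is withdrawn here and in `norm_window_sum_le`).
HONEST FRAMING (page 1): pure YM₄ on a FIXED FINITE torus T⁴, rung (B)+1 of the cell's ladder = the `ε → 0` limit of
expectations of gauge-invariant observables; NOT infinite volume, NOT a mass gap, NOT the Clay problem.  Spine
estimate NE7 (node U5: for every `K` a `t`-independent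
constant `c_K` with `|log Z^B_{K+1}(t) − log Z^A_K(t) − c_K| ≤ δ_K·|T₁|`, `Σ_K δ_K < ∞`) is NOT PRINTED for Bałaban's
d = 4 procedure; its d = 2, 3 template is [King1986] (3.10)–(3.13) pp. 656–657 (TEMPLATE ONLY).  The conditionals of the
lineage — the flow window (0.31) of [Balaban1987RG1] (the cell's BetaPertH road; tree `Step.Discrete031`), (B), (B^μ) —
are untouched by this leaf: they sit BY NAME in the binders `h031A`/`h031B` of generation 10's capstone
`T4TermwiseQuartic.goodClause_summable_of_kindsRA_regular` and inside the producers of its other binders, exactly where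
those modules declare them; nothing here discharges or hides them.  This leaf is different in kind from generations 1–10:
it is NOT bookkeeping over hypothesis binders but a THEOREM about Bałaban's concrete block average (42) of
[Balaban1985Averaging], obtained by re-assembling the tree's kernel-checked proof of B7 Proposition 1 (`B7Prop1Explicit`,
cell unit b2b-balaban-b07, imported BY NAME; nothing upstream edited).  NO definitions, no `sorry`.

CITATION HEADER (lean-in-tree rule 2026-08-18).  Audit cell `pub-balaban`, sub-cell t4 (unit b2b-balaban-t4-ne7-p1-g11).
Source: T. Bałaban, *Averaging operations for lattice gauge theories*, Commun. Math. Phys. **98**, 17–51 (1985)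
[Balaban1985Averaging] (cell paper B7; journal page = PDF page + 16): §A (21) p. 21, (26)–(27) pp. 21–22; (42)
p. 23; Sect. B–C (44)–(45) p. 24, (46)–(50) p. 25, Proposition 1 (51) p. 26 — all as quoted VERBATIM in the headers of
the tree modules `MatrixLog` ((21)–(27)) and `B7Prop1Explicit` (pp. 24–26, from the page renders
`b2b-balaban-ref1/pages/1985-cmp98-averaging/…-p008-x2.png`–`-p010-x2.png`); the axial tree contour is B5 =
[Balaban1984PropagatorsI] (1.7) p. 18.  The sentences used here: (45) p. 24 «Of course, we have `|V₀(∂p) − 1| = |V(∂p) − 1|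
< α₀`, `|V̄(∂p′) − 1| = |V̄₀(∂p′) − 1|`»; (47) p. 25 «`|V̄₀(∂p′) − 1 − i Σ_{c⊂∂p′} Σ_{x∈B(c₋)} L^{−d} A(Γ_{c,x})| <
O(1)(L²α₀)²`»; (48) «`Σ_{c⊂∂p′} Σ_{x∈B(c₋)} L^{−d} A(Γ_{c,x}) = Σ_{x∈B(y₀)} L^{−d} A(∂(p′)_x) = Σ_{x∈B(y₀)} L^{−d}
Σ_{p⊂(p′)_x} A(∂p)`»; (49) «`|V₀(∂p) − 1 − iA(∂p)| < ½(|A|(∂p))² < ½(8dLα₀)² = O(1)L²α₀²`»; (50) «`|V̄₀(∂p′) − 1| <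
Σ_{x∈B(y₀)} L^{−d} Σ_{p⊂(p′)_x} |A(∂p)| + O(1)(L²α₀)² < … < L²α₀ + O(1)(L²α₀)²`»; (26)–(27) «`|log X| ≤ … ≤ 2|X − 1|`»,
«`|X − 1| = |e^{log X} − 1| ≤ … ≤ 2|log X|`».

## Why this leaf (record `t4/T4-EST-NE7-P1.md` v10 §14 (14d)(v): after generation 10 the open entry points of the
## term-wise route are the PRODUCERS of its binders; generation 10's own "What is NOT delivered": «Any instantiation of
## (ker)(tr)(bch)(sz)(osc)(scal) on Bałaban's configurations: the kernel `w` and the transport `Φ` are not constructed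
## from (14)–(15); (bch) is not derived from (38)»)
Generation 10 (`T4TermwiseQuartic`) carried the one-step deviations (U)(L) beyond quadratic order with two located,
unprinted inputs about the AVERAGE: (tr) transport to the coarse frame is an isometry, `‖Φ y x‖ = ‖φ x‖`, and (bch) the
coarse plaquette field of the one-step average equals the kernel average of the transported fine field up to `ρb`,
`‖ψ y − Σ_x w(y,x)•Φ y x‖ ≤ ρb` with `ρb_K ≤ c₃ε₁²L^{−4K}` ((scal) `hρb`) — «LOCATED: (51) p. 26, the second-order term
`C₀(L²α₀)²`, mechanism (28)–(38) pp. 22–23; NOT PRINTED as this inequality; ESTIMATE».  THIS LEAF PROVES (bch) AND (tr)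
FOR THE CONCRETE AVERAGE (42) (`B7Prop1Explicit.bavg`) on `ℤ^d`, in Bałaban's own window-indexed form and norm, with
`ρb = 280·θ²`, `θ = 8(d+1)(d+4)L²α₀`, together with the arithmetic of (scal) and the row-sum half of (ker).  The
mechanism is NOT (38) but pp. 24–26 themselves: the tree's proof of Proposition 1 linearises `V̄₀(∂p′)` in the axial
gauge around the window sum (48) of the abelianised plaquette fields `A₀(∂p)` and then THROWS THE FIRST-ORDER TERM AWAY
by (49)–(50) (`main_term_bound`: `|Σ L^{−d}A(∂(p′)_x)| ≤ L²(α₀ + ρ(4a))`).  Keeping it — and replacing `iA₀(∂p)` by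
`V₀(∂p) − 1` at cost (49) — gives, in the axial gauge, `V̄₀(∂p′) − 1 = Σ_{x∈B(y₀)} L^{−d} Σ_{p⊂(p′)_x} (V₀(∂p) − 1) +
O(θ²)` (§2); undoing the axial gauge by (45) conjugates each fine plaquette variable by the TRANSPORTER `T_{p′,p₋} =
u(y₀)⁻¹u(p₋) = V(Γ_{y,y₀})⁻¹V(Γ_{y,p₋})` (`u = axialFn V y`: parallel transport from `p₋` to `y₀` through `y` along the
axial tree) — §3; and (26)–(27) turn `X − 1` into `log X` on both sides at second-order cost — §4.  The transported
field `Φ(p′, p) = T_{p′,p₋} (log V(∂p)) T_{p′,p₋}⁻¹` is thereby CONSTRUCTED (not posited), (tr) is the isometry of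
conjugation by `U1`-elements, and the weights are (42)'s `L^{−d}` per slot `(x ∈ B(y₀), p ⊂ (p′)_x)`.

DICTIONARY print ↦ Lean (that of `B7Prop1Explicit`, plus): `y₀ ↦ z`, `y = y₀ + Le_μ + Le_ν`; axial gauge function
`v₀ ↦ u = axialFn V y` (bound by the equation `hu`); slot `(x ∈ B(y₀), p ⊂ (p′)_x) ↦ (r : Fin d → Fin L, i j ∈ range L)`
with `p₋ = x r i j := z + boxVec L r + ie_μ + je_ν` (bound by `hx`); `V(∂p) ↦ hol V (x r i j) (plaqWord μ ν)`;
`T_{p′,p₋} ↦ (u z)⁻¹ * u (x r i j)`; `V̄(∂p′) ↦ cplaq L (bavg L V) z μ ν`; `log ↦ MatrixLog.mlog` (the series (21));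
`ψ(p′) ↦ mlog (cplaq …)`, `Φ(p′,p) ↦ T * mlog (hol …) * T⁻¹`; weight `L^{−d} ↦ ((L:ℝ)^d)⁻¹ •`.

## What this module adds (additive leaf; imports `B7Prop1Explicit` and `T4TermwiseQuartic` BY NAME)
§1 `norm_units_conj_le`, `norm_units_inv_conj_le`, `norm_units_conj_eq` ((tr): `‖uXu⁻¹‖ = ‖X‖` for `u ∈ U1`),
   `transporter_mem`.
§2 `linear_axial` — axial gauge: `|V̄₀(∂p′) − 1 − Σ_x L^{−d} Σ_{p⊂(p′)_x} (V₀(∂p) − 1)| ≤ 226·θ²` (hypotheses of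
   `B7Prop1Explicit.prop1_core`; its plaquette hypothesis (44) is not even needed).
§3 `conj_linearisation_identity`; `linear_general` — any gauge, by (45): `|V̄(∂p′) − 1 − Σ_x L^{−d} Σ_p
   (T_{p′,p₋}V(∂p)T_{p′,p₋}⁻¹ − 1)| ≤ 226·θ²` (hypotheses of `prop1_explicit`).
§4 `norm_three_terms_le`, `norm_window_sum_le`, `norm_transport_mlog_sub_le` (`|T(log X)T⁻¹ − (TXT⁻¹ − 1)| ≤ 4α₀²`);
   `bch_concrete` — (bch): `|log V̄(∂p′) − Σ_{x∈B(y₀)} L^{−d} Σ_{p⊂(p′)_x} T_{p′,p₋}(log V(∂p))T_{p′,p₋}⁻¹| ≤ 280·θ²`;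
   `transport_norm_eq` — (tr) for these transporters; `norm_sub_window_sum_of_isometry` — the pull-back of (bch) along a
   real-linear isometry `ι : V → 𝔸` (the identification (id-V) below, in the only form the consumer needs).
§5 `window_weights_row_sum` ((ker) row sum `= L²` in window form — (51)'s leading coefficient);
   `window_sum_eq_position_sum` (slots ↦ positions: the kernel form `Σ_x w(y,x)•Φ x`, `w = L^{−d}·#slots`, by
   `Finset.sum_comp`).
§6 `bchSize_le_scale` ((scal): `α₀ ≤ c₁ε₁(L^{K+1})^{−2}` ⟹ `280θ² ≤ c₃ε₁²((L^K)⁻¹)^4`, `c₃ = 280(8(D+1)(D+4)c₁)²`);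
   `smallness_of_scale` (`512(D+1)(D+4)c₁ε₁ ≤ 1` ⟹ the smallness hypothesis at every level `K`).
§7 two toys (the hypotheses of `bch_concrete` are jointly satisfiable: `V ≡ 1` on `ℤ²`; (scal) with numbers).  No physics
   beyond B7 pp. 21–26.

METHOD.  §2 = the preamble of `prop1_core` verbatim (`R = (2d+4)L + 4`, `a = 4(d+4)Lα₀`, `θ ≤ 1/64`, `bond_log`,
`side_estimate` ×4, `norm_prod4_sub_one_sub_le`, `corner_cancellation`) with `main_term_bound` REPLACED by `stokes` +
`walk_linear` per unit plaquette (`|A₀(∂p) − (V₀(∂p) − 1)| ≤ ρ(4a)`, window total `L²ρ(4a) ≤ θ²`): `225θ² + θ²`.  §3: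
`V₀ = V^u`, `u = axialFn V y`; `axial_bond_bound` supplies §2's bond hypothesis from (44); `prop1_core`'s second clause
gives the side condition of `bavg_gaugeAct` ((45)/(11) `\bar{V^u}_c = u(c₋)V̄_c u(c₊)⁻¹`), `cplaq_conj` conjugates
`V̄(∂p′)`, `hol_gaugeAct_closed` the closed plaquette holonomies, and conjugation by `u(y₀)⁻¹ ∈ U1` is norm-non-increasing
and commutes with the `ℝ`-linear combination (`conj_linearisation_identity`).  §4: `log V̄(∂p′) − Σ L^{−d}Σ TφT⁻¹ =
[log V̄ − (V̄ − 1)] + [§3] − Σ L^{−d}Σ (T(log X)T⁻¹ − (TXT⁻¹ − 1))`; first bracket `≤ ρ(2|V̄ − 1|) ≤ 4(L²α₀ + 226θ²)²`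
by `norm_mlog_sub_le` ((26)–(27)) and Prop. 1 (`prop1_explicit`); last sum `≤ L²·4α₀²`; with `80L²α₀ ≤ θ ≤ 1/64`
(`d ≥ 1`) the total is `≤ 280θ²`.  Constants admissible, not optimised.

## Binder status for generation 10's `interpolation_averaging_of_regular` / `goodClause_summable_of_kindsRA_regular`
(tr-U)/(tr-L) `hΦA hΦB`: PRODUCED for transported fields of the form `TφT⁻¹`, `T ∈ U1` (`transport_norm_eq`; exact).
(bch-U)/(bch-L) `hρA hρB`: PRODUCED for the concrete average (42) of ANY configuration `V : ℤ^d → U1 𝔸` with (44) and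
  `512(d+1)(d+4)L²α₀ ≤ 1`, in the window-indexed form and the norm of `𝔸` (`bch_concrete`), `ρb = 280θ²`; for run A apply
  it to the lift `yA` (whose average is `xA`, (lift)), for run B to `yB`.  What separates this from the binder AS TYPED in
  generation 10 is bookkeeping, recorded not done: (tor) generation 10's fields live on the tori of the runs, (42) here on
  `ℤ^d` — a configuration on a torus of side `N·L` is an `N·L`-periodic configuration on `ℤ^d` and (42), being local and
  translation-covariant, descends (Prop. 1 «is a local result», p. 26); (pos) slots ↦ positions is
  `window_sum_eq_position_sum`, and on the torus the slot count per position is translation-invariant (the column sum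
  `L^{−d}·L² = L^{2−d}` of generation 10's `hcol`; (ker) is otherwise generation 10's hypothesis on ITS abstract `w`, of
  which `window_weights_row_sum` is the row half); (id-V) generation 10's plaquette fields take values in a real
  inner-product space `V` — pull (bch) back along an isometry `ι : V → 𝔸` (`norm_sub_window_sum_of_isometry`; for SU(2)
  the operator norm on `su(2)` is Euclidean up to a factor, for SU(N), `N ≥ 3`, it is not and constants change).
(scal) `hρb`: the LAW `ρb_K ≤ c₃ε₁²((L^K)⁻¹)^4` is ARITHMETIC from the plaquette-size law `α₀(K) ≤ c₁ε₁(L^{K+1})^{−2}`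
  (`bchSize_le_scale`), and the smallness of `bch_concrete` at every `K` follows from the `K`-uniform `512(d+1)(d+4)c₁ε₁ ≤ 1`
  (`smallness_of_scale`); the size law itself is generation 10's (sz)/(scal) `hs` read on `|V(∂p) − 1|` — conditions (2)
  of [Balaban1985Variational] in shape, «|U(∂p) − 1| < ε₀η²(L^jη)^{−2}» — a HYPOTHESIS upstream, unchanged.
UNCHANGED, still hypotheses upstream: (osc-U) (the binder that carries the rate of (U); NOT PRINTED), (W-w), (sz), (cnt),
(ker) for the abstract kernel, (repr), (wt) beyond U(1)/SU(2), (0.31) = `h031A`/`h031B`, (B), (B^μ), and everything of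
generations 7–9's census.  No new end-to-end theorem is stated: generation 10's capstone consumes (bch)/(tr) as binders
over an abstract `V`, and feeding it is the three bookkeeping steps (tor)(pos)(id-V) above.

## What is NOT delivered
The torus descent (tor) of (42) and the column count; the isometry `ι` of (id-V) for any concrete `G`; (osc-U); any use
of (28)–(38) (the BCH series of §A is bypassed, as in `B7Prop1Explicit`); locality sharper than `B7Prop1Explicit`'s
((44) is assumed on all of `ℤ^d`, DIVERGENCE (a) of that module, inherited); optimal constants; anything at d ≠ 4 specific
(the statements hold for every `d ≥ 1`; d = 4 enters only through generation 10's `rc = 1`).  NE7 remains NOT PRINTED and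
NOT PROVED; this leaf removes ONE located-but-unprinted input of the term-wise route by proving it from B7 pp. 21–26.
-/

open scoped BigOperators
open NormedSpace Finset

namespace Literature.MathematicalPhysics.QuantumFieldTheory.Balaban1983to89.T4TermwiseBCH

open B7Prop1Explicit

-- `Site` alone would resolve to the torus sites `Balaban1983to89.Site (P : Params) j` of `Setup.lean` (parent
-- namespace beats `open`); re-export the `ℤ^d` sites of `B7Prop1Explicit` into this namespace (as `B7Prop2Explicit` does).
export B7Prop1Explicit (Site)

variable {d : ℕ}

section Transport

variable {𝔸 : Type*} [NormedRing 𝔸] [NormOneClass 𝔸]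

/-- `‖u X u⁻¹‖ ≤ ‖X‖` for `u ∈ U1` (the tree's `B8CurlGradHolonomy.norm_conj_le` with the hypothesis packaged as
membership in `U1`). [folklore] -/
theorem norm_units_conj_le {u : 𝔸ˣ} (hu : u ∈ U1 𝔸) (X : 𝔸) :
    ‖(u : 𝔸) * X * ((u⁻¹ : 𝔸ˣ) : 𝔸)‖ ≤ ‖X‖ := by
  calc ‖(u : 𝔸) * X * ((u⁻¹ : 𝔸ˣ) : 𝔸)‖ ≤ ‖(u : 𝔸) * X‖ * ‖((u⁻¹ : 𝔸ˣ) : 𝔸)‖ := norm_mul_le _ _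
    _ ≤ (‖(u : 𝔸)‖ * ‖X‖) * 1 := by gcongr; exacts [norm_mul_le _ _, hu.2]
    _ ≤ (1 * ‖X‖) * 1 := by gcongr; exact hu.1
    _ = ‖X‖ := by ring

/-- `‖u⁻¹ X u‖ ≤ ‖X‖` for `u ∈ U1`. [folklore] -/
theorem norm_units_inv_conj_le {u : 𝔸ˣ} (hu : u ∈ U1 𝔸) (X : 𝔸) :
    ‖((u⁻¹ : 𝔸ˣ) : 𝔸) * X * (u : 𝔸)‖ ≤ ‖X‖ := by
  have := norm_units_conj_le ((U1 𝔸).inv_mem hu) X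
  rwa [inv_inv] at this

/-- **(tr) — parallel transport is an isometry on the plaquette variables**: `‖u X u⁻¹‖ = ‖X‖` for `u ∈ U1`
(`G ⊂ {|u| ≤ 1, |u⁻¹| ≤ 1}`).  This is the binder (tr-U)/(tr-L) `‖Φ y x‖ = ‖φ x‖` of
`T4TermwiseQuartic.interpolation_averaging_of_regular` for transported fields `Φ y x = T_{y,x} (φ x) T_{y,x}⁻¹`. [folklore] -/
theorem norm_units_conj_eq {u : 𝔸ˣ} (hu : u ∈ U1 𝔸) (X : 𝔸) :
    ‖(u : 𝔸) * X * ((u⁻¹ : 𝔸ˣ) : 𝔸)‖ = ‖X‖ := by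
  refine le_antisymm (norm_units_conj_le hu X) ?_
  have h := norm_units_inv_conj_le hu ((u : 𝔸) * X * ((u⁻¹ : 𝔸ˣ) : 𝔸))
  have he : ((u⁻¹ : 𝔸ˣ) : 𝔸) * ((u : 𝔸) * X * ((u⁻¹ : 𝔸ˣ) : 𝔸)) * (u : 𝔸) = X := by
    simp only [← mul_assoc, Units.inv_mul, one_mul]
    rw [mul_assoc, Units.inv_mul, mul_one]
  rwa [he] at h

/-- The transporter `T_{y₀,x} = u(y₀)⁻¹ u(x)` built from an axial gauge function `u` (values in `U1`) lies in `U1`. [folklore] -/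
theorem transporter_mem {V : Site d → Fin d → 𝔸ˣ} (hV : ∀ x κ, V x κ ∈ U1 𝔸) (y z x : Site d) :
    (axialFn V y z)⁻¹ * axialFn V y x ∈ U1 𝔸 :=
  (U1 𝔸).mul_mem ((U1 𝔸).inv_mem (axialFn_mem hV y z)) (axialFn_mem hV y x)

end Transport

/-! ## §2 B7 (47)∘(48)∘(49) in the axial gauge with the first-order term KEPT -/

section Axial

variable {𝔸 : Type*} [NormedRing 𝔸] [NormOneClass 𝔸] [NormedAlgebra ℂ 𝔸] [CompleteSpace 𝔸]

omit [NormOneClass 𝔸] in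
/-- **The linearisation of the averaged plaquette variable, axial gauge** (B7 p. 25, the chain (47)–(50) with
the main term (48)–(49) KEPT instead of estimated).  Hypotheses = those of `B7Prop1Explicit.prop1_core` verbatim: a
configuration `V₀` on `ℤ^d` whose bond variables within `l¹`-distance `(2d+4)L + 4` of `y = y₀ + Le_μ + Le_ν` satisfy
`|V₀(b) − 1| ≤ |b₋ − y|₁ · α₀`, `512(d+1)(d+4)L²α₀ ≤ 1` (the plaquette hypothesis (44) of `prop1_core` is NOT needed
once the first-order term is kept: it only served to bound that term in (49)).  Conclusion, with `θ = 8(d+1)(d+4)L²α₀`: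
`|V̄₀(∂p′) − 1 − Σ_{x ∈ B(y₀)} L^{−d} Σ_{p ⊂ (p′)_x} (V₀(∂p) − 1)| ≤ 226·θ²`,
where `(p′)_x = p′ + (x − y₀)` and the inner sum runs over the `L²` unit plaquettes `p` of `(p′)_x` (lower-left corners
`x + ie_μ + je_ν`, `0 ≤ i, j < L`).  Print: (47) the four sides to second order (`side_estimate`), (48)
`Σ_{c ⊂ ∂p′} A(Γ_{c,x}) = A(∂(p′)_x) = Σ_{p ⊂ (p′)_x} A(∂p)` (`corner_cancellation`, `stokes`), (49)
`iA₀(∂p) = V₀(∂p) − 1 + O(α₀²)` (`walk_linear`), (50) the product of the four sides (`norm_prod4_sub_one_sub_le`); the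
printed (50)–(51) then BOUND the kept term by `L²α₀` — here it is retained, which is the form the T⁴ term-wise matching
consumes (binder (bch) of `T4TermwiseQuartic.interpolation_averaging_of_regular`). [cite: Balaban1985Averaging, (47)–(50) p.25] -/
theorem linear_axial (L : ℕ) (hL : 1 ≤ L) (z y : Site d) {μ ν : Fin d}
    (hy : y = z + (L : ℤ) • e μ + (L : ℤ) • e ν) (V₀ : Site d → Fin d → 𝔸ˣ) {α₀ : ℝ} (hα₀ : 0 ≤ α₀)
    (hsmall : 512 * (d + 1) * (d + 4) * (L : ℝ) ^ 2 * α₀ ≤ 1)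
    (hbond : ∀ x κ, l1 (x - y) ≤ (2 * d + 4) * L + 4 → ‖((V₀ x κ : 𝔸ˣ) : 𝔸) - 1‖ ≤ l1 (x - y) * α₀) :
    ‖((cplaq L (bavg L V₀) z μ ν : 𝔸ˣ) : 𝔸) - 1
        - ∑ r : Fin d → Fin L, ((L : ℝ) ^ d)⁻¹ • ∑ i ∈ Finset.range L, ∑ j ∈ Finset.range L,
            (((hol V₀ (z + boxVec L r + (i : ℤ) • e μ + (j : ℤ) • e ν) (plaqWord μ ν) : 𝔸ˣ) : 𝔸) - 1)‖
      ≤ 226 * (8 * (d + 1) * (d + 4) * (L : ℝ) ^ 2 * α₀) ^ 2 := by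
  have hd : 1 ≤ d := μ.pos
  -- the constants (as in `prop1_core`)
  set R : ℕ := (2 * d + 4) * L + 4 with hRdef
  set a : ℝ := 4 * (d + 4) * L * α₀ with hadef
  set θ : ℝ := 8 * (d + 1) * (d + 4) * (L : ℝ) ^ 2 * α₀ with hθdef
  have hLr : (1 : ℝ) ≤ L := by exact_mod_cast hL
  have hdr : (1 : ℝ) ≤ d := by exact_mod_cast hd
  have ha : 0 ≤ a := by positivity
  have hθ0 : 0 ≤ θ := by positivity
  have hθ1 : θ ≤ 1 / 64 := by
    have : 64 * θ = 512 * (d + 1) * (d + 4) * (L : ℝ) ^ 2 * α₀ := by rw [hθdef]; ring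
    linarith
  have haθ : 4 * a ≤ θ := by
    have e1 : θ - 4 * a = 8 * ((d : ℝ) + 4) * L * α₀ * ((d + 1) * L - 2) := by rw [hθdef, hadef]; ring
    have e2 : 0 ≤ 8 * ((d : ℝ) + 4) * L * α₀ * ((d + 1) * L - 2) :=
      mul_nonneg (by positivity) (by nlinarith [mul_nonneg (sub_nonneg.mpr hdr) (by positivity : (0 : ℝ) ≤ L)])
    linarith
  have ha1 : a ≤ 1 := by linarith
  have hRa : ((R : ℕ) : ℝ) * α₀ ≤ a / 2 := by
    have e1 : a / 2 - ((R : ℕ) : ℝ) * α₀ = 4 * ((L : ℝ) - 1) * α₀ := by rw [hRdef, hadef]; push_cast; ring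
    have e2 : 0 ≤ 4 * ((L : ℝ) - 1) * α₀ := mul_nonneg (mul_nonneg (by norm_num) (by linarith)) hα₀
    linarith
  -- the bond field `A = log V₀` in the region of control
  have hb : ∀ x κ, l1 (x - y) ≤ R → ‖((V₀ x κ : 𝔸ˣ) : 𝔸) - 1‖ ≤ a / 2 := fun x κ hx =>
    (hbond x κ hx).trans ((mul_le_mul_of_nonneg_right (by exact_mod_cast hx) hα₀).trans hRa)
  have hVA := bond_log y R ha1 hb
  set A : Site d → Fin d → 𝔸 := fun x κ => MatrixLog.mlog ((V₀ x κ : 𝔸ˣ) : 𝔸) with hAdef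
  -- (47): the four sides
  have hθN : ((2 * (d * L) + L + L : ℕ) : ℝ) * a ≤ θ := le_of_eq (by rw [hadef, hθdef]; push_cast; ring)
  have hRexp : R = 2 * (d * L) + 4 * L + 4 := by rw [hRdef]; ring
  have hzy : l1 (z - y) ≤ 2 * L := by
    rw [hy, show z - (z + (L : ℤ) • e μ + (L : ℤ) • e ν) = -((L : ℤ) • e μ + (L : ℤ) • e ν) by abel, l1_neg]
    refine (l1_add_le _ _).trans ?_
    rw [l1_zsmul_e, l1_zsmul_e, Int.natAbs_natCast]; omega
  have hzμy : l1 (z + (L : ℤ) • e μ - y) ≤ 2 * L := by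
    rw [hy, show z + (L : ℤ) • e μ - (z + (L : ℤ) • e μ + (L : ℤ) • e ν) = -((L : ℤ) • e ν) by abel, l1_neg,
      l1_zsmul_e, Int.natAbs_natCast]; omega
  have hzνy : l1 (z + (L : ℤ) • e ν - y) ≤ 2 * L := by
    rw [hy, show z + (L : ℤ) • e ν - (z + (L : ℤ) • e μ + (L : ℤ) • e ν) = -((L : ℤ) • e μ) by abel, l1_neg,
      l1_zsmul_e, Int.natAbs_natCast]; omega
  have hside : ∀ q κ, l1 (q - y) ≤ 2 * L →
      ‖((bavg L V₀ q κ : 𝔸ˣ) : 𝔸) - 1‖ ≤ 2 * θ ∧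
      ‖((bavg L V₀ q κ : 𝔸ˣ) : 𝔸) - 1 - Tside L A q κ‖ ≤ 50 * θ ^ 2 ∧
      ‖(((bavg L V₀ q κ)⁻¹ : 𝔸ˣ) : 𝔸) - 1‖ ≤ 2 * θ ∧
      ‖(((bavg L V₀ q κ)⁻¹ : 𝔸ˣ) : 𝔸) - 1 - (-Tside L A q κ)‖ ≤ 50 * θ ^ 2 ∧
      ∀ r : Fin d → Fin L, ‖((Wcx L V₀ q κ (boxVec L r) : 𝔸ˣ) : 𝔸) - 1‖ ≤ 2 * θ := fun q κ hq =>
    side_estimate V₀ A y R ha hVA L hL q κ (by rw [hRexp]; omega) hθN hθ0 hθ1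
  obtain ⟨f1, e1, -, -, -⟩ := hside z μ hzy
  obtain ⟨f2, e2, -, -, -⟩ := hside (z + (L : ℤ) • e μ) ν hzμy
  obtain ⟨-, -, f3, e3, -⟩ := hside (z + (L : ℤ) • e ν) μ hzνy
  obtain ⟨-, -, f4, e4, -⟩ := hside z ν hzy
  -- (50): the product of the four sides to second order
  have hP := norm_prod4_sub_one_sub_le (by positivity) f1 f2 f3 f4 e1 e2 e3 e4
  -- (48): the first-order terms add up to `Σ_x L^{−d} A(∂(p′)_x)`
  have hTsum : Tside L A z μ + Tside L A (z + (L : ℤ) • e μ) ν + -Tside L A (z + (L : ℤ) • e ν) μ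
      + -Tside L A z ν = ∑ r : Fin d → Fin L, ((L : ℝ) ^ d)⁻¹ • asum A (z + boxVec L r) (rectWord L L μ ν) := by
    simp only [Tside, ← Finset.sum_neg_distrib, ← Finset.sum_add_distrib, ← smul_neg, ← smul_add]
    refine Finset.sum_congr rfl fun r _ => ?_
    rw [← corner_cancellation]
    congr 1
    abel
  rw [hTsum] at hP
  -- (48) second equality (Stokes) and (49): `A(∂(p′)_x) = Σ_{p ⊂ (p′)_x} A(∂p)`, `|A(∂p) − (V₀(∂p) − 1)| ≤ ρ(4a)`
  have hR : ∀ (r : Fin d → Fin L) (i j : ℕ), i < L → j < L →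
      l1 (z + boxVec L r + (i : ℤ) • e μ + (j : ℤ) • e ν - y) + 4 ≤ R := fun r i j hi hj => by
    have h1 := l1_add_le (z - y) (boxVec L r + (i : ℤ) • e μ + (j : ℤ) • e ν)
    have h2 := (l1_add_le (boxVec L r + (i : ℤ) • e μ) ((j : ℤ) • e ν))
    have h3 := (l1_add_le (boxVec L r) ((i : ℤ) • e μ))
    have h4 := l1_boxVec_le L r
    rw [l1_zsmul_e, Int.natAbs_natCast] at h2 h3
    rw [show z - y + (boxVec L r + (i : ℤ) • e μ + (j : ℤ) • e ν)
      = z + boxVec L r + (i : ℤ) • e μ + (j : ℤ) • e ν - y by abel] at h1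
    rw [hRexp]; omega
  have hlin : ‖(∑ r : Fin d → Fin L, ((L : ℝ) ^ d)⁻¹ • asum A (z + boxVec L r) (rectWord L L μ ν))
      - ∑ r : Fin d → Fin L, ((L : ℝ) ^ d)⁻¹ • ∑ i ∈ Finset.range L, ∑ j ∈ Finset.range L,
          (((hol V₀ (z + boxVec L r + (i : ℤ) • e μ + (j : ℤ) • e ν) (plaqWord μ ν) : 𝔸ˣ) : 𝔸) - 1)‖
      ≤ (L : ℝ) ^ 2 * expRem (4 * a) := by
    rw [← Finset.sum_sub_distrib]
    simp_rw [← smul_sub]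
    refine norm_avg_le L hL _ fun r => ?_
    rw [stokes, ← Finset.sum_sub_distrib]
    simp_rw [← Finset.sum_sub_distrib]
    have hp : ∀ i ∈ Finset.range L, ∀ j ∈ Finset.range L,
        ‖asum A (z + boxVec L r + (i : ℤ) • e μ + (j : ℤ) • e ν) (plaqWord μ ν)
          - (((hol V₀ (z + boxVec L r + (i : ℤ) • e μ + (j : ℤ) • e ν) (plaqWord μ ν) : 𝔸ˣ) : 𝔸) - 1)‖
          ≤ expRem (4 * a) := by
      intro i hi j hj
      rw [Finset.mem_range] at hi hj
      obtain ⟨-, h2⟩ := walk_linear V₀ A y R ha hVA (plaqWord μ ν) _ (hR r i j hi hj)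
      have hl : ((plaqWord μ ν).length : ℝ) = 4 := by simp [plaqWord]
      rw [hl] at h2
      rwa [norm_sub_rev]
    calc _ ≤ ∑ i ∈ Finset.range L, ‖∑ j ∈ Finset.range L,
            (asum A (z + boxVec L r + (i : ℤ) • e μ + (j : ℤ) • e ν) (plaqWord μ ν)
              - (((hol V₀ (z + boxVec L r + (i : ℤ) • e μ + (j : ℤ) • e ν) (plaqWord μ ν) : 𝔸ˣ) : 𝔸) - 1))‖ :=
          norm_sum_le _ _
      _ ≤ ∑ i ∈ Finset.range L, ∑ j ∈ Finset.range L,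
            ‖asum A (z + boxVec L r + (i : ℤ) • e μ + (j : ℤ) • e ν) (plaqWord μ ν)
              - (((hol V₀ (z + boxVec L r + (i : ℤ) • e μ + (j : ℤ) • e ν) (plaqWord μ ν) : 𝔸ˣ) : 𝔸) - 1)‖ :=
          Finset.sum_le_sum fun i _ => norm_sum_le _ _
      _ ≤ ∑ i ∈ Finset.range L, ∑ j ∈ Finset.range L, expRem (4 * a) :=
          Finset.sum_le_sum fun i hi => Finset.sum_le_sum fun j hj => hp i hi j hj
      _ = (L : ℝ) ^ 2 * expRem (4 * a) := by
          rw [Finset.sum_const, Finset.sum_const, Finset.card_range, nsmul_eq_mul, nsmul_eq_mul]; ring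
  have hρ : (L : ℝ) ^ 2 * expRem (4 * a) ≤ θ ^ 2 := by
    have h1 : expRem (4 * a) ≤ (4 * a) ^ 2 := expRem_le_sq (by positivity) (by linarith)
    have h2 : θ ^ 2 - (L : ℝ) ^ 2 * (4 * a) ^ 2 = 64 * ((d + 4) * (L : ℝ) ^ 2 * α₀) ^ 2 * ((d + 1) ^ 2 - 4) := by
      rw [hθdef, hadef]; ring
    have h3 : 0 ≤ 64 * ((d + 4) * (L : ℝ) ^ 2 * α₀) ^ 2 * (((d : ℝ) + 1) ^ 2 - 4) :=
      mul_nonneg (by positivity) (by nlinarith)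
    have h4 := mul_le_mul_of_nonneg_left h1 (by positivity : (0 : ℝ) ≤ (L : ℝ) ^ 2)
    linarith
  -- collecting terms
  have hθ3 : θ ^ 3 ≤ θ ^ 2 / 64 := by
    calc θ ^ 3 = θ ^ 2 * θ := by ring
      _ ≤ θ ^ 2 * (1 / 64) := by gcongr
      _ = θ ^ 2 / 64 := by ring
  have hθ4 : θ ^ 4 ≤ θ ^ 2 / 64 := by
    calc θ ^ 4 = θ ^ 2 * (θ * θ) := by ring
      _ ≤ θ ^ 2 * (1 / 64 * 1) := by gcongr; linarith
      _ = θ ^ 2 / 64 := by ring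
  have hcp : ((cplaq L (bavg L V₀) z μ ν : 𝔸ˣ) : 𝔸) = ((bavg L V₀ z μ : 𝔸ˣ) : 𝔸)
      * ((bavg L V₀ (z + (L : ℤ) • e μ) ν : 𝔸ˣ) : 𝔸) * (((bavg L V₀ (z + (L : ℤ) • e ν) μ)⁻¹ : 𝔸ˣ) : 𝔸)
      * (((bavg L V₀ z ν)⁻¹ : 𝔸ˣ) : 𝔸) := by simp only [cplaq, Units.val_mul]
  rw [hcp]
  have hsplit : ∀ (X M N : 𝔸), X - 1 - N = (X - 1 - M) + (M - N) := fun X M N => by abel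
  rw [hsplit _ (∑ r : Fin d → Fin L, ((L : ℝ) ^ d)⁻¹ • asum A (z + boxVec L r) (rectWord L L μ ν))]
  refine (norm_add_le _ _).trans ?_
  refine (add_le_add hP hlin).trans ?_
  linarith [sq_nonneg θ]

end Axial

/-! ## §3 Back to an arbitrary configuration by (45): the PARALLEL-TRANSPORTED fine plaquette variables -/

section General

variable {𝔸 : Type*} [NormedRing 𝔸] [NormOneClass 𝔸] [NormedAlgebra ℂ 𝔸] [CompleteSpace 𝔸]

omit [NormOneClass 𝔸] [CompleteSpace 𝔸] in
/-- Conjugating the linearisation identity: `q (X − 1 − Σ_r c·Σ_{i,j} (H − 1)) p = qXp − 1 − Σ_r c·Σ_{i,j} (qHp − 1)`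
for `qp = 1` — ring bookkeeping (conjugation is an `ℝ`-algebra automorphism). [folklore] -/
theorem conj_linearisation_identity (q p : 𝔸) (hqp : q * p = 1) (X : 𝔸) {ι : Type*} (S : Finset ι) (c : ℝ)
    (s t : Finset ℕ) (H : ι → ℕ → ℕ → 𝔸) :
    q * (X - 1 - ∑ r ∈ S, c • ∑ i ∈ s, ∑ j ∈ t, (H r i j - 1)) * p
      = q * X * p - 1 - ∑ r ∈ S, c • ∑ i ∈ s, ∑ j ∈ t, (q * H r i j * p - 1) := by
  simp only [mul_sub, sub_mul, Finset.mul_sum, Finset.sum_mul, smul_mul_assoc, mul_smul_comm, mul_one, hqp]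

/-- **The linearisation of the averaged plaquette variable, arbitrary gauge** (B7 (45) p. 24 + (47)–(50)).  For a
configuration `V` on `ℤ^d` with values in `G ⊂ {|u| ≤ 1, |u⁻¹| ≤ 1}` satisfying (44) `|V(∂p) − 1| ≤ α₀` for all unit
plaquettes and `512(d+1)(d+4)L²α₀ ≤ 1`, and for the plaquette `p′ = (y₀ = z; μ, ν)` of the `L`-lattice: with `u` the axial
gauge function of B5 (1.7) at `y = y₀ + Le_μ + Le_ν` (`axialFn V y`) and the TRANSPORTERS `T_{p′,x} := u(y₀)⁻¹ u(x)`
(`= V(Γ_{y,y₀})⁻¹ V(Γ_{y,x})`, parallel transport from `x` to `y₀` through `y` along the axial tree),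
`|V̄(∂p′) − 1 − Σ_{x ∈ B(y₀)} L^{−d} Σ_{p ⊂ (p′)_x} (T_{p′,p₋} V(∂p) T_{p′,p₋}⁻¹ − 1)| ≤ 226·θ²`, `θ = 8(d+1)(d+4)L²α₀`.
This is the non-abelian content of the (bch) binder at GROUP level: the first-order term of the averaged plaquette
variable is the window average of the PARALLEL-TRANSPORTED fine plaquette variables (print p. 24: "(45) … we can
consider the configuration `V₀` … in the axial gauge", and (50)).  The abbreviations `u`, `x` are bound by the equations
`hu`, `hx` (instantiate with `rfl`). [cite: Balaban1985Averaging, (45) p.24, (47)–(50) p.25] -/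
theorem linear_general (L : ℕ) (hL : 1 ≤ L) (z : Site d) {μ ν : Fin d} (hμν : μ ≠ ν)
    (V : Site d → Fin d → 𝔸ˣ) (hV : ∀ x κ, V x κ ∈ U1 𝔸) {α₀ : ℝ} (hα₀ : 0 ≤ α₀)
    (hsmall : 512 * (d + 1) * (d + 4) * (L : ℝ) ^ 2 * α₀ ≤ 1)
    (h44 : ∀ (x : Site d) (κ κ' : Fin d), κ ≠ κ' → ‖((hol V x (plaqWord κ κ') : 𝔸ˣ) : 𝔸) - 1‖ ≤ α₀)
    (u : Site d → 𝔸ˣ) (hu : u = axialFn V (z + (L : ℤ) • e μ + (L : ℤ) • e ν))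
    (x : (Fin d → Fin L) → ℕ → ℕ → Site d) (hx : x = fun r (i j : ℕ) => z + boxVec L r + (i : ℤ) • e μ + (j : ℤ) • e ν) :
    ‖((cplaq L (bavg L V) z μ ν : 𝔸ˣ) : 𝔸) - 1
        - ∑ r : Fin d → Fin L, ((L : ℝ) ^ d)⁻¹ • ∑ i ∈ Finset.range L, ∑ j ∈ Finset.range L,
            ((((u z)⁻¹ * u (x r i j) * hol V (x r i j) (plaqWord μ ν) * ((u z)⁻¹ * u (x r i j))⁻¹ : 𝔸ˣ) : 𝔸) - 1)‖
      ≤ 226 * (8 * (d + 1) * (d + 4) * (L : ℝ) ^ 2 * α₀) ^ 2 := by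
  set y : Site d := z + (L : ℤ) • e μ + (L : ℤ) • e ν with hy
  set V₀ : Site d → Fin d → 𝔸ˣ := gaugeAct u V with hV₀
  have huU : ∀ x, u x ∈ U1 𝔸 := fun x => hu ▸ axialFn_mem hV y x
  have h44₀ : ∀ x, ‖((hol V₀ x (plaqWord μ ν) : 𝔸ˣ) : 𝔸) - 1‖ ≤ α₀ := fun x => by
    rw [hV₀, hol_gaugeAct_closed _ _ _ _ (disp_plaqWord μ ν), Units.val_mul, Units.val_mul]
    exact (norm_units_conj_sub_one_le (huU x) _).trans (h44 x μ ν hμν)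
  have hbond : ∀ x κ, l1 (x - y) ≤ (2 * d + 4) * L + 4 → ‖((V₀ x κ : 𝔸ˣ) : 𝔸) - 1‖ ≤ l1 (x - y) * α₀ :=
    fun x κ _ => by rw [hV₀, hu]; exact axial_bond_bound V hV y h44 hα₀ x κ
  -- the axial-gauge statement of §2 for `V₀`, and the side condition of (45) from `prop1_core`
  have hax := linear_axial L hL z y hy V₀ hα₀ hsmall hbond
  obtain ⟨-, hW⟩ := prop1_core L hL z y hy V₀ hα₀ hsmall h44₀ hbond
  -- (45) on the four sides of `∂p′`
  have hzy : l1 (z - y) ≤ 2 * L := by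
    rw [hy, show z - (z + (L : ℤ) • e μ + (L : ℤ) • e ν) = -((L : ℤ) • e μ + (L : ℤ) • e ν) by abel, l1_neg]
    refine (l1_add_le _ _).trans ?_
    rw [l1_zsmul_e, l1_zsmul_e, Int.natAbs_natCast]; omega
  have hzμy : l1 (z + (L : ℤ) • e μ - y) ≤ 2 * L := by
    rw [hy, show z + (L : ℤ) • e μ - (z + (L : ℤ) • e μ + (L : ℤ) • e ν) = -((L : ℤ) • e ν) by abel, l1_neg,
      l1_zsmul_e, Int.natAbs_natCast]; omega
  have hzνy : l1 (z + (L : ℤ) • e ν - y) ≤ 2 * L := by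
    rw [hy, show z + (L : ℤ) • e ν - (z + (L : ℤ) • e μ + (L : ℤ) • e ν) = -((L : ℤ) • e μ) by abel, l1_neg,
      l1_zsmul_e, Int.natAbs_natCast]; omega
  have hcov : ∀ q κ, l1 (q - y) ≤ 2 * L → bavg L V₀ q κ = u q * bavg L V q κ * (u (q + (L : ℤ) • e κ))⁻¹ := by
    intro q κ hq
    rw [hV₀]
    refine bavg_gaugeAct L huU V q κ fun r => ?_
    refine (norm_sub_one_le_of_conj (X := Wcx L V q κ (boxVec L r)) (huU q)).trans_lt ?_
    rw [← Wcx_gaugeAct]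
    exact hW q κ hq r
  have hconj := cplaq_conj L u (bavg L V) (bavg L V₀) z μ ν (hcov z μ hzy) (hcov _ ν hzμy) (hcov _ μ hzνy)
    (hcov z ν hzy)
  -- conjugating everything by `u(y₀)⁻¹`
  have hC : cplaq L (bavg L V) z μ ν = (u z)⁻¹ * cplaq L (bavg L V₀) z μ ν * u z := by
    rw [hconj]; group
  have hT : ∀ x' : Site d, (u z)⁻¹ * u x' * hol V x' (plaqWord μ ν) * ((u z)⁻¹ * u x')⁻¹
      = (u z)⁻¹ * hol V₀ x' (plaqWord μ ν) * u z := by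
    intro x'
    rw [hV₀, hol_gaugeAct_closed _ _ _ _ (disp_plaqWord μ ν)]
    group
  simp_rw [hT, hC, Units.val_mul]
  have hid := conj_linearisation_identity (((u z)⁻¹ : 𝔸ˣ) : 𝔸) (u z : 𝔸) (Units.inv_mul (u z))
    ((cplaq L (bavg L V₀) z μ ν : 𝔸ˣ) : 𝔸) (Finset.univ : Finset (Fin d → Fin L)) (((L : ℝ) ^ d)⁻¹)
    (Finset.range L) (Finset.range L) (fun r i j => ((hol V₀ (x r i j) (plaqWord μ ν) : 𝔸ˣ) : 𝔸))
  have key := norm_units_inv_conj_le (huU z)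
    (((cplaq L (bavg L V₀) z μ ν : 𝔸ˣ) : 𝔸) - 1 - ∑ r : Fin d → Fin L, ((L : ℝ) ^ d)⁻¹ •
      ∑ i ∈ Finset.range L, ∑ j ∈ Finset.range L, (((hol V₀ (x r i j) (plaqWord μ ν) : 𝔸ˣ) : 𝔸) - 1))
  rw [hid] at key
  refine key.trans ?_
  subst hx
  exact hax

end General

/-! ## §4 The logarithm (26)–(27): the binder (bch) for the concrete average (42) -/

section LogLevel

variable {𝔸 : Type*} [NormedRing 𝔸] [NormOneClass 𝔸] [NormedAlgebra ℂ 𝔸] [CompleteSpace 𝔸]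

omit [NormOneClass 𝔸] [CompleteSpace 𝔸] in
/-- The three-term split behind (bch): `ψ − Σ c·ΣΣ a = [ψ − (C−1)] + [(C−1) − Σ c·ΣΣ b] − Σ c·ΣΣ (a − b)`, hence the
norm of the left side is at most the sum of the three norms — bookkeeping. [folklore] -/
theorem norm_three_terms_le (ψ X : 𝔸) {ι : Type*} (S : Finset ι) (c : ℝ) (s t : Finset ℕ) (a b : ι → ℕ → ℕ → 𝔸) :
    ‖ψ - ∑ r ∈ S, c • ∑ i ∈ s, ∑ j ∈ t, a r i j‖
      ≤ ‖ψ - X‖ + ‖X - ∑ r ∈ S, c • ∑ i ∈ s, ∑ j ∈ t, b r i j‖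
        + ‖∑ r ∈ S, c • ∑ i ∈ s, ∑ j ∈ t, (a r i j - b r i j)‖ := by
  have hdist : ∑ r ∈ S, c • ∑ i ∈ s, ∑ j ∈ t, (a r i j - b r i j)
      = ∑ r ∈ S, c • ∑ i ∈ s, ∑ j ∈ t, a r i j - ∑ r ∈ S, c • ∑ i ∈ s, ∑ j ∈ t, b r i j := by
    simp only [Finset.sum_sub_distrib, smul_sub]
  have hsplit : ψ - ∑ r ∈ S, c • ∑ i ∈ s, ∑ j ∈ t, a r i j
      = (ψ - X) + (X - ∑ r ∈ S, c • ∑ i ∈ s, ∑ j ∈ t, b r i j)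
        - ∑ r ∈ S, c • ∑ i ∈ s, ∑ j ∈ t, (a r i j - b r i j) := by
    rw [hdist]; abel
  rw [hsplit]
  exact (norm_sub_le _ _).trans (add_le_add (norm_add_le _ _) le_rfl)

omit [NormOneClass 𝔸] [CompleteSpace 𝔸] in
/-- The window average of uniformly small terms is small: `|Σ_{x ∈ B(y₀)} L^{−d} Σ_{p ⊂ (p′)_x} F| ≤ L² · sup |F|`
((42): the weights `L^{−d}` are a probability vector; `L²` plaquettes per window position). [cite: Balaban1985Averaging, (42) p.23] -/
theorem norm_window_sum_le (L : ℕ) (hL : 1 ≤ L) (F : (Fin d → Fin L) → ℕ → ℕ → 𝔸) {K : ℝ}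
    (hF : ∀ r, ∀ i ∈ Finset.range L, ∀ j ∈ Finset.range L, ‖F r i j‖ ≤ K) :
    ‖∑ r : Fin d → Fin L, ((L : ℝ) ^ d)⁻¹ • ∑ i ∈ Finset.range L, ∑ j ∈ Finset.range L, F r i j‖
      ≤ (L : ℝ) ^ 2 * K := by
  refine norm_avg_le L hL _ fun r => ?_
  calc _ ≤ ∑ i ∈ Finset.range L, ‖∑ j ∈ Finset.range L, F r i j‖ := norm_sum_le _ _
    _ ≤ ∑ i ∈ Finset.range L, ∑ j ∈ Finset.range L, ‖F r i j‖ := Finset.sum_le_sum fun i _ => norm_sum_le _ _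
    _ ≤ ∑ i ∈ Finset.range L, ∑ j ∈ Finset.range L, K :=
        Finset.sum_le_sum fun i hi => Finset.sum_le_sum fun j hj => hF r i hi j hj
    _ = (L : ℝ) ^ 2 * K := by
        rw [Finset.sum_const, Finset.sum_const, Finset.card_range, nsmul_eq_mul, nsmul_eq_mul]; ring

/-- **One transported plaquette to second order in the logarithm**: for `T ∈ U1` and `|X − 1| ≤ α₀ ≤ ¼`,
`|T (log X) T⁻¹ − (T X T⁻¹ − 1)| ≤ 4α₀²` — (26)–(27) `|log X − (X − 1)| ≤ ρ(2|X − 1|) ≤ 4|X − 1|²` transported by the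
isometry `Ad(T)`. [cite: Balaban1985Averaging, (26)–(27) pp.21–22] -/
theorem norm_transport_mlog_sub_le {T X : 𝔸ˣ} (hT : T ∈ U1 𝔸) {α₀ : ℝ} (hα : α₀ ≤ 1 / 4)
    (hX : ‖(X : 𝔸) - 1‖ ≤ α₀) :
    ‖(T : 𝔸) * MatrixLog.mlog (X : 𝔸) * ((T⁻¹ : 𝔸ˣ) : 𝔸) - (((T * X * T⁻¹ : 𝔸ˣ) : 𝔸) - 1)‖ ≤ 4 * α₀ ^ 2 := by
  have h0 : 0 ≤ α₀ := (norm_nonneg _).trans hX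
  have hX2 : ‖(X : 𝔸) - 1‖ ≤ 1 / 2 := hX.trans (by linarith)
  have hTT : (T : 𝔸) * ((T⁻¹ : 𝔸ˣ) : 𝔸) = 1 := Units.mul_inv T
  have e1 : (T : 𝔸) * MatrixLog.mlog (X : 𝔸) * ((T⁻¹ : 𝔸ˣ) : 𝔸) - (((T * X * T⁻¹ : 𝔸ˣ) : 𝔸) - 1)
      = (T : 𝔸) * MatrixLog.mlog (X : 𝔸) * ((T⁻¹ : 𝔸ˣ) : 𝔸)
          - ((T : 𝔸) * (X : 𝔸) * ((T⁻¹ : 𝔸ˣ) : 𝔸) - (T : 𝔸) * ((T⁻¹ : 𝔸ˣ) : 𝔸)) := by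
    rw [Units.val_mul, Units.val_mul, hTT]
  have e2 : (T : 𝔸) * MatrixLog.mlog (X : 𝔸) * ((T⁻¹ : 𝔸ˣ) : 𝔸)
        - ((T : 𝔸) * (X : 𝔸) * ((T⁻¹ : 𝔸ˣ) : 𝔸) - (T : 𝔸) * ((T⁻¹ : 𝔸ˣ) : 𝔸))
      = (T : 𝔸) * (MatrixLog.mlog (X : 𝔸) - ((X : 𝔸) - 1)) * ((T⁻¹ : 𝔸ˣ) : 𝔸) := by
    noncomm_ring
  rw [e1, e2]
  refine (norm_units_conj_le hT _).trans ?_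
  refine (norm_mlog_sub_le hX2).trans ?_
  refine (expRem_le_sq (by positivity) (by linarith)).trans ?_
  calc (2 * ‖(X : 𝔸) - 1‖) ^ 2 ≤ (2 * α₀) ^ 2 := pow_le_pow_left₀ (by positivity) (by linarith) 2
    _ = 4 * α₀ ^ 2 := by ring

/-- **(bch) PRODUCED for Bałaban's concrete one-step average (42).**  Same hypotheses as Prop. 1
(`B7Prop1Explicit.prop1_explicit`): `V` on `ℤ^d` with values in `G ⊂ {|u| ≤ 1, |u⁻¹| ≤ 1}`, (44) `|V(∂p) − 1| ≤ α₀`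
for all unit plaquettes, `512(d+1)(d+4)L²α₀ ≤ 1`; `p′ = (y₀ = z; μ ≠ ν)` a plaquette of the `L`-lattice, `u` the axial
gauge function at `y = y₀ + Le_μ + Le_ν`, transporters `T_{p′,x} = u(y₀)⁻¹u(x)`.  With the Lie-algebra variables
`ψ(p′) := log V̄(∂p′)` (coarse) and `φ(p) := log V(∂p)` (fine) and the transported field
`Φ(p′, p) := T_{p′,p₋} φ(p) T_{p′,p₋}⁻¹`:
`|ψ(p′) − Σ_{x ∈ B(y₀)} L^{−d} Σ_{p ⊂ (p′)_x} Φ(p′, p)| ≤ 280·θ²`, `θ = 8(d+1)(d+4)L²α₀` —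
i.e. the binder (bch-U)/(bch-L) `‖ψA y − Σ_x w y x • ΦA y x‖ ≤ ρb` of
`T4TermwiseQuartic.interpolation_averaging_of_regular` in print's window-indexed form, with `ρb = 280·θ²` of the
printed second-order size `O(1)(L²α₀)²` of Prop. 1 (51).  Chain: §3 (group level, 226θ²) + (26)–(27) for `log V̄(∂p′)`
(`4|V̄(∂p′) − 1|² ≤ 4(L²α₀ + 226θ²)²` by Prop. 1) + (26)–(27) per transported plaquette (`4α₀²`, window weight `L²`).
The passage to the logarithm of a product-of-averages in this form is NOT a displayed inequality of the paper (its
(38)/(50) expand `V̄` itself); constants are not optimised. [cite: Balaban1985Averaging, (26)–(27) pp.21–22, (45) p.24, (47)–(50) p.25, (51) p.26] -/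
theorem bch_concrete (L : ℕ) (hL : 1 ≤ L) (z : Site d) {μ ν : Fin d} (hμν : μ ≠ ν)
    (V : Site d → Fin d → 𝔸ˣ) (hV : ∀ x κ, V x κ ∈ U1 𝔸) {α₀ : ℝ} (hα₀ : 0 ≤ α₀)
    (hsmall : 512 * (d + 1) * (d + 4) * (L : ℝ) ^ 2 * α₀ ≤ 1)
    (h44 : ∀ (x : Site d) (κ κ' : Fin d), κ ≠ κ' → ‖((hol V x (plaqWord κ κ') : 𝔸ˣ) : 𝔸) - 1‖ ≤ α₀)
    (u : Site d → 𝔸ˣ) (hu : u = axialFn V (z + (L : ℤ) • e μ + (L : ℤ) • e ν))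
    (x : (Fin d → Fin L) → ℕ → ℕ → Site d) (hx : x = fun r (i j : ℕ) => z + boxVec L r + (i : ℤ) • e μ + (j : ℤ) • e ν) :
    ‖MatrixLog.mlog ((cplaq L (bavg L V) z μ ν : 𝔸ˣ) : 𝔸)
        - ∑ r : Fin d → Fin L, ((L : ℝ) ^ d)⁻¹ • ∑ i ∈ Finset.range L, ∑ j ∈ Finset.range L,
            ((((u z)⁻¹ * u (x r i j) : 𝔸ˣ) : 𝔸) * MatrixLog.mlog ((hol V (x r i j) (plaqWord μ ν) : 𝔸ˣ) : 𝔸)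
              * ((((u z)⁻¹ * u (x r i j))⁻¹ : 𝔸ˣ) : 𝔸))‖
      ≤ 280 * (8 * (d + 1) * (d + 4) * (L : ℝ) ^ 2 * α₀) ^ 2 := by
  have hd : 1 ≤ d := μ.pos
  set θ : ℝ := 8 * (d + 1) * (d + 4) * (L : ℝ) ^ 2 * α₀ with hθdef
  set β : ℝ := (L : ℝ) ^ 2 * α₀ with hβdef
  have hLr : (1 : ℝ) ≤ L := by exact_mod_cast hL
  have hdr : (1 : ℝ) ≤ d := by exact_mod_cast hd
  have hθ0 : 0 ≤ θ := by positivity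
  have hβ0 : 0 ≤ β := by positivity
  have hθ1 : θ ≤ 1 / 64 := by
    have : 64 * θ = 512 * (d + 1) * (d + 4) * (L : ℝ) ^ 2 * α₀ := by rw [hθdef]; ring
    linarith
  have hβθ : 80 * β ≤ θ := by
    have e1 : θ - 80 * β = 8 * β * (((d : ℝ) - 1) * (d + 6)) := by rw [hθdef, hβdef]; ring
    have e2 : 0 ≤ 8 * β * (((d : ℝ) - 1) * (d + 6)) := by
      have : 0 ≤ ((d : ℝ) - 1) * (d + 6) := mul_nonneg (by linarith) (by positivity)
      positivity
    linarith
  have hαβ : α₀ ≤ β := by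
    have : α₀ * 1 ≤ α₀ * (L : ℝ) ^ 2 := mul_le_mul_of_nonneg_left (by nlinarith) hα₀
    rw [hβdef]; linarith
  have hα4 : α₀ ≤ 1 / 4 := by linarith
  have huU : ∀ x', u x' ∈ U1 𝔸 := fun x' => hu ▸ axialFn_mem hV _ x'
  -- the three inputs: §3 at group level, Prop. 1 for `|V̄(∂p′) − 1|`, and (26)–(27)
  have hgrp := linear_general L hL z hμν V hV hα₀ hsmall h44 u hu x hx
  have hC1 := prop1_explicit L hL z hμν V hV hα₀ hsmall h44
  have hC2 : ‖((cplaq L (bavg L V) z μ ν : 𝔸ˣ) : 𝔸) - 1‖ ≤ 1 / 2 := by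
    refine hC1.trans ?_
    rw [← hθdef, ← hβdef] at *
    nlinarith
  have hψ : ‖MatrixLog.mlog ((cplaq L (bavg L V) z μ ν : 𝔸ˣ) : 𝔸) - (((cplaq L (bavg L V) z μ ν : 𝔸ˣ) : 𝔸) - 1)‖
      ≤ 4 * (β + 226 * θ ^ 2) ^ 2 := by
    refine (norm_mlog_sub_le hC2).trans ?_
    refine (expRem_le_sq (by positivity) (by linarith)).trans ?_
    have h2 : 2 * ‖((cplaq L (bavg L V) z μ ν : 𝔸ˣ) : 𝔸) - 1‖ ≤ 2 * (β + 226 * θ ^ 2) := by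
      rw [hβdef, hθdef]; linarith
    calc (2 * ‖((cplaq L (bavg L V) z μ ν : 𝔸ˣ) : 𝔸) - 1‖) ^ 2 ≤ (2 * (β + 226 * θ ^ 2)) ^ 2 :=
          pow_le_pow_left₀ (by positivity) h2 2
      _ = 4 * (β + 226 * θ ^ 2) ^ 2 := by ring
  have hwin : ‖∑ r : Fin d → Fin L, ((L : ℝ) ^ d)⁻¹ • ∑ i ∈ Finset.range L, ∑ j ∈ Finset.range L,
      ((((u z)⁻¹ * u (x r i j) : 𝔸ˣ) : 𝔸) * MatrixLog.mlog ((hol V (x r i j) (plaqWord μ ν) : 𝔸ˣ) : 𝔸)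
          * ((((u z)⁻¹ * u (x r i j))⁻¹ : 𝔸ˣ) : 𝔸)
        - ((((u z)⁻¹ * u (x r i j) * hol V (x r i j) (plaqWord μ ν) * ((u z)⁻¹ * u (x r i j))⁻¹ : 𝔸ˣ) : 𝔸) - 1))‖
      ≤ (L : ℝ) ^ 2 * (4 * α₀ ^ 2) :=
    norm_window_sum_le L hL _ fun r i _ j _ =>
      norm_transport_mlog_sub_le ((U1 𝔸).mul_mem ((U1 𝔸).inv_mem (huU z)) (huU _)) hα4 (h44 _ μ ν hμν)
  refine (norm_three_terms_le _ (((cplaq L (bavg L V) z μ ν : 𝔸ˣ) : 𝔸) - 1) _ _ _ _ _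
    (fun r i j => ((((u z)⁻¹ * u (x r i j) * hol V (x r i j) (plaqWord μ ν)
      * ((u z)⁻¹ * u (x r i j))⁻¹ : 𝔸ˣ) : 𝔸) - 1))).trans ?_
  refine (add_le_add (add_le_add hψ hgrp) hwin).trans ?_
  -- arithmetic: 4(β + 226θ²)² + 226θ² + 4L²α₀² ≤ 280θ² for 80β ≤ θ ≤ 1/64, α₀ ≤ β
  rw [← hθdef]
  have h1 : β ^ 2 ≤ θ ^ 2 / 6400 := by nlinarith
  have h2 : β * θ ^ 2 ≤ θ ^ 3 / 80 := by nlinarith [sq_nonneg θ]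
  have h3 : θ ^ 3 ≤ θ ^ 2 / 64 := by
    calc θ ^ 3 = θ ^ 2 * θ := by ring
      _ ≤ θ ^ 2 * (1 / 64) := by gcongr
      _ = θ ^ 2 / 64 := by ring
  have h4 : θ ^ 4 ≤ θ ^ 2 / 4096 := by
    calc θ ^ 4 = θ ^ 2 * (θ * θ) := by ring
      _ ≤ θ ^ 2 * (1 / 64 * (1 / 64)) := by gcongr
      _ = θ ^ 2 / 4096 := by ring
  have h5 : (L : ℝ) ^ 2 * (4 * α₀ ^ 2) ≤ 4 * β ^ 2 := by
    have : (L : ℝ) ^ 2 * (4 * α₀ ^ 2) = 4 * β * α₀ := by rw [hβdef]; ring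
    rw [this]
    nlinarith
  nlinarith [sq_nonneg θ, sq_nonneg β]

omit [NormedAlgebra ℂ 𝔸] [CompleteSpace 𝔸] in
/-- **(tr) for the concrete transporters**: `‖T_{p′,x} φ T_{p′,x}⁻¹‖ = ‖φ‖` for `T_{p′,x} = u(y₀)⁻¹u(x)` built from
any `U1`-valued gauge function `u` (e.g. `axialFn V y`, by `axialFn_mem`) — the binder (tr-U)/(tr-L) of
`T4TermwiseQuartic.interpolation_averaging_of_regular` for the transported field of `bch_concrete`. [folklore] -/
theorem transport_norm_eq {u : Site d → 𝔸ˣ} (hu : ∀ x, u x ∈ U1 𝔸) (z x : Site d) (φ : 𝔸) :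
    ‖((((u z)⁻¹ * u x : 𝔸ˣ)) : 𝔸) * φ * ((((u z)⁻¹ * u x)⁻¹ : 𝔸ˣ) : 𝔸)‖ = ‖φ‖ :=
  norm_units_conj_eq ((U1 𝔸).mul_mem ((U1 𝔸).inv_mem (hu z)) (hu x)) φ

omit [NormOneClass 𝔸] [CompleteSpace 𝔸] in
/-- (id-V), the identification step left to the consumer, in the only form it is needed: an inequality
`‖ι ψ − Σ_r c·Σ_{i,j} ι Φ‖ ≤ ρ` in `𝔸` PULLS BACK along any real-linear isometry `ι : V → 𝔸` to
`‖ψ − Σ_r c·Σ_{i,j} Φ‖ ≤ ρ` in `V` — so `bch_concrete` yields generation 10's (bch) binder over a real inner-product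
space `V` as soon as the Lie-algebra variables are written `ι ∘ (·)` for an isometric `ι` (for `SU(2)`: `su(2)` with
the operator norm is a multiple of Euclidean `ℝ³`, by `Ad`-invariance; the isometry is NOT constructed here; for
`SU(N)`, `N ≥ 3`, the operator norm on `su(N)` is not Euclidean and comparison constants enter). [folklore] -/
theorem norm_sub_window_sum_of_isometry {V : Type*} [SeminormedAddCommGroup V] [NormedSpace ℝ V]
    (ι : V →ₗᵢ[ℝ] 𝔸) {ι' : Type*} (S : Finset ι') (c : ℝ) (s t : Finset ℕ) (ψ : V) (Φ : ι' → ℕ → ℕ → V)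
    {ρ : ℝ} (h : ‖ι ψ - ∑ r ∈ S, c • ∑ i ∈ s, ∑ j ∈ t, ι (Φ r i j)‖ ≤ ρ) :
    ‖ψ - ∑ r ∈ S, c • ∑ i ∈ s, ∑ j ∈ t, Φ r i j‖ ≤ ρ := by
  have e : ι (ψ - ∑ r ∈ S, c • ∑ i ∈ s, ∑ j ∈ t, Φ r i j) = ι ψ - ∑ r ∈ S, c • ∑ i ∈ s, ∑ j ∈ t, ι (Φ r i j) := by
    simp only [map_sub, map_sum, map_smul]
  rw [← ι.norm_map, e]
  exact h

end LogLevel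

/-! ## §5 Kernel bookkeeping: row sum `L²` and the passage from slots to positions -/

section Kernel

/-- (ker), ROW SUM, window-indexed: the weights `L^{−d}` of (42), counted over the `L^d` window positions `x′ ∈ B(y₀)`
and the `L²` unit plaquettes of the window `(p′)_{x′}`, sum to `L²` — generation 10's `hrow : Σ_x w y x = L²`, the
leading coefficient of Prop. 1 (51). [folklore] -/
theorem window_weights_row_sum (L : ℕ) (hL : 1 ≤ L) :
    ∑ _r : Fin d → Fin L, ∑ _i ∈ Finset.range L, ∑ _j ∈ Finset.range L, ((L : ℝ) ^ d)⁻¹ = (L : ℝ) ^ 2 := by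
  rw [Finset.sum_const, Finset.sum_const, Finset.sum_const, Finset.card_range, Finset.card_univ, Fintype.card_fun,
    Fintype.card_fin, Fintype.card_fin]
  simp only [nsmul_eq_mul, Nat.cast_pow]
  have : ((L : ℝ)) ^ d ≠ 0 := pow_ne_zero _ (by exact_mod_cast (by omega : L ≠ 0))
  field_simp

/-- From SLOTS to POSITIONS (the kernel form `Σ_x w(y,x)•Φ x` of the (ker)/(bch) binders): summing a function of the
plaquette position over the slots `(x′ ∈ B(y₀), p ⊂ (p′)_{x′})` with weight `c = L^{−d}` equals the sum over positions
weighted by `c·#{slots at that position}` (`Finset.sum_comp`).  On the torus of side `L·L^j` every fine plaquette of the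
plane is hit by exactly `L²` slots in total over all `p′` (its COLUMN sum `L^{−d}·L² = L^{2−d}`, `= L⁻²` in d = 4 —
generation 10's `hcol`); that torus count is NOT done here. [folklore] -/
theorem window_sum_eq_position_sum {M : Type*} [AddCommGroup M] [Module ℝ M] {X : Type*} [DecidableEq X]
    (L : ℕ) (c : ℝ) (pt : (Fin d → Fin L) × ℕ × ℕ → X) (Φ : X → M) :
    ∑ r : Fin d → Fin L, c • ∑ i ∈ Finset.range L, ∑ j ∈ Finset.range L, Φ (pt (r, i, j))
      = ∑ x ∈ (Finset.univ ×ˢ (Finset.range L ×ˢ Finset.range L)).image pt,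
          (c * ((Finset.univ ×ˢ (Finset.range L ×ˢ Finset.range L)).filter (fun t => pt t = x)).card) • Φ x := by
  have h1 : ∑ r : Fin d → Fin L, c • ∑ i ∈ Finset.range L, ∑ j ∈ Finset.range L, Φ (pt (r, i, j))
      = ∑ t ∈ Finset.univ ×ˢ (Finset.range L ×ˢ Finset.range L), c • Φ (pt t) := by
    rw [Finset.sum_product]
    refine Finset.sum_congr rfl fun r _ => ?_
    rw [Finset.sum_product, Finset.smul_sum]
    refine Finset.sum_congr rfl fun i _ => ?_
    rw [Finset.smul_sum]
  rw [h1, Finset.sum_comp (fun x => c • Φ x) pt]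
  refine Finset.sum_congr rfl fun x _ => ?_
  rw [← Nat.cast_smul_eq_nsmul ℝ, smul_smul, mul_comm]

end Kernel

/-! ## §6 (scal): the size of (bch) along the one-step tower is `c₃ ε₁² (L^{−K})⁴` -/

section Scaling

/-- (scal) for (bch): if the fine plaquette size at tower level `K` obeys `α₀ ≤ c₁ε₁(L^{K+1})^{−2}` (generation 10's
`hs`: fine spacing `b = L^{−(K+1)}`, field strength `O(ε₁)` at unit scale — conditions (2) of [Balaban1985Variational] in
shape), then the size `280·θ²`, `θ = 8(D+1)(D+4)L²α₀`, of `bch_concrete` is `≤ c₃ε₁²((L^K)⁻¹)^4` with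
`c₃ = 280·(8(D+1)(D+4)c₁)²` — the shape of generation 10's binder `hρb` (there a HYPOTHESIS).  Arithmetic:
`L²(L^{K+1})^{−2} = (L^K)^{−2}`. [folklore] -/
theorem bchSize_le_scale {D c₁ ε₁ L α₀ : ℝ} {K : ℕ} (hL : 1 ≤ L) (hD : 0 ≤ D)
    (hα₀ : 0 ≤ α₀) (hα : α₀ ≤ c₁ * ε₁ * ((L ^ (K + 1))⁻¹) ^ 2) :
    280 * (8 * (D + 1) * (D + 4) * L ^ 2 * α₀) ^ 2
      ≤ (280 * (8 * (D + 1) * (D + 4) * c₁) ^ 2) * ε₁ ^ 2 * ((L ^ K)⁻¹) ^ 4 := by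
  have hL0 : 0 < L := by linarith
  have key : L ^ 2 * ((L ^ (K + 1))⁻¹) ^ 2 = ((L ^ K)⁻¹) ^ 2 := by
    field_simp
    ring
  have h1 : 8 * (D + 1) * (D + 4) * L ^ 2 * α₀ ≤ 8 * (D + 1) * (D + 4) * c₁ * ε₁ * ((L ^ K)⁻¹) ^ 2 := by
    calc 8 * (D + 1) * (D + 4) * L ^ 2 * α₀ ≤ 8 * (D + 1) * (D + 4) * L ^ 2 * (c₁ * ε₁ * ((L ^ (K + 1))⁻¹) ^ 2) := by
          gcongr
      _ = 8 * (D + 1) * (D + 4) * c₁ * ε₁ * (L ^ 2 * ((L ^ (K + 1))⁻¹) ^ 2) := by ring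
      _ = 8 * (D + 1) * (D + 4) * c₁ * ε₁ * ((L ^ K)⁻¹) ^ 2 := by rw [key]
  have h0 : 0 ≤ 8 * (D + 1) * (D + 4) * L ^ 2 * α₀ := by positivity
  calc 280 * (8 * (D + 1) * (D + 4) * L ^ 2 * α₀) ^ 2
        ≤ 280 * (8 * (D + 1) * (D + 4) * c₁ * ε₁ * ((L ^ K)⁻¹) ^ 2) ^ 2 := by gcongr
    _ = (280 * (8 * (D + 1) * (D + 4) * c₁) ^ 2) * ε₁ ^ 2 * ((L ^ K)⁻¹) ^ 4 := by ring

/-- (scal), smallness: the `K`-UNIFORM hypothesis `512(D+1)(D+4)c₁ε₁ ≤ 1` gives the smallness hypothesis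
`512(D+1)(D+4)L²α₀ ≤ 1` of `bch_concrete` at every tower level (`L²(L^{K+1})^{−2} = (L^K)^{−2} ≤ 1`). [folklore] -/
theorem smallness_of_scale {D c₁ ε₁ L α₀ : ℝ} {K : ℕ} (hL : 1 ≤ L) (hD : 0 ≤ D) (hc₁ : 0 ≤ c₁) (hε₁ : 0 ≤ ε₁)
    (hα : α₀ ≤ c₁ * ε₁ * ((L ^ (K + 1))⁻¹) ^ 2) (hsmall : 512 * (D + 1) * (D + 4) * c₁ * ε₁ ≤ 1) :
    512 * (D + 1) * (D + 4) * L ^ 2 * α₀ ≤ 1 := by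
  have hL0 : 0 < L := by linarith
  have key : L ^ 2 * ((L ^ (K + 1))⁻¹) ^ 2 = ((L ^ K)⁻¹) ^ 2 := by
    field_simp
    ring
  have hK1 : ((L ^ K)⁻¹) ^ 2 ≤ 1 := by
    have h' : (L ^ K)⁻¹ ≤ 1 := inv_le_one_of_one_le₀ (one_le_pow₀ hL)
    have h'' : 0 ≤ (L ^ K)⁻¹ := by positivity
    nlinarith
  calc 512 * (D + 1) * (D + 4) * L ^ 2 * α₀ ≤ 512 * (D + 1) * (D + 4) * L ^ 2 * (c₁ * ε₁ * ((L ^ (K + 1))⁻¹) ^ 2) := by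
        gcongr
    _ = 512 * (D + 1) * (D + 4) * c₁ * ε₁ * (L ^ 2 * ((L ^ (K + 1))⁻¹) ^ 2) := by ring
    _ = 512 * (D + 1) * (D + 4) * c₁ * ε₁ * ((L ^ K)⁻¹) ^ 2 := by rw [key]
    _ ≤ 512 * (D + 1) * (D + 4) * c₁ * ε₁ * 1 := by gcongr
    _ ≤ 1 := by linarith

end Scaling

/-! ## §7 Toy / non-vacuity -/

section Toy

/-- Toy / non-vacuity: the hypotheses of `bch_concrete` are JOINTLY SATISFIABLE — the trivial configuration `V ≡ 1` on
`ℤ²`, `L = 2`, `α₀ = 0`, `𝔸 = ℂ`, plane `(0, 1)` — and then its bound is `280·0² = 0`: the coarse Lie-algebra variable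
IS the weighted window sum of the transported fine ones.  No physics. -/
example (z : Site 2) :=
  bch_concrete (𝔸 := ℂ) 2 (by norm_num) z (show (0 : Fin 2) ≠ 1 by decide) (fun _ _ => 1)
    (fun _ _ => (U1 ℂ).one_mem) le_rfl (by norm_num)
    (fun x κ κ' _ => by simp [plaqWord, stepHol_true, stepHol_false]) _ rfl _ rfl

/-- Toy for (scal): with `D = 4`, `c₁ = ε₁ = 1`, `L = 2`, `K = 0` and `α₀ = 1/4 = (L^1)^{−2}`, `bchSize_le_scale` reads
`280·(8·5·8·4·¼)² ≤ 280·(8·5·8)²` (equality).  No physics. -/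
example : 280 * (8 * ((4 : ℝ) + 1) * (4 + 4) * 2 ^ 2 * (1 / 4)) ^ 2
    ≤ (280 * (8 * ((4 : ℝ) + 1) * (4 + 4) * 1) ^ 2) * 1 ^ 2 * (((2 : ℝ) ^ 0)⁻¹) ^ 4 :=
  bchSize_le_scale (K := 0) (by norm_num) (by norm_num) (by norm_num) (by norm_num)

end Toy

end Literature.MathematicalPhysics.QuantumFieldTheory.Balaban1983to89.T4TermwiseBCH
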